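import Literature.Topology.FourManifolds.SmaleDiffDisc
import Literature.Topology.FourManifolds.CapGermAlignment
import Literature.AlgebraicTopology.SingularHomology.ReflectionLocalDegree
import HarnessLib

/-!
# A reflection of the sphere is not homotopic to the identity; `π₀ Diff(S²) → [S², S²]` is injective

Fact seat of `Literature.Topology.FourManifolds.BudneyGabai2019_thm_3_13`
(`NonSeparatingSpheres.lean`; R. Budney, D. Gabai, *Knotted 3-balls in `S⁴`*, arXiv:1912.09029,
Thm. 3.13), classical case `n = 2`: the monodromy of the fibration of the cyclic cover produced
by the argument of `NonSeparatingSpheresFibred.lean` is a diffeomorphism of `S²` *homotopic* to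
the identity, and the descent to `S¹ × S²` needs it *diffeotopic* to the identity.  By Smale's
theorem in Cerf's form (`Diffeomorph.isDiffeotopicToId_or_isDiffeotopic_sphereReflection_two`,
`SmaleDiffDisc.lean`) a diffeomorphism of `S²` is diffeotopic to the identity or to a
reflection, so it remains to see that **a reflection of `Sᵐ⁺¹` is not homotopic to the
identity** (Hatcher, *Algebraic Topology* (2002), §2.2, property (e) of the degree, p. 134:
`deg = -1 ≠ 1`).  We read this off the tree's homological input
`map_reflPunctured_zero_ne_id` (`ReflectionLocalDegree.lean`: the coordinate reflection is not
the identity on `Hₘ₊₁(ℝᵐ⁺² ∖ 0; ℤ)`) through the radial homotopy equivalence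
`Sᵐ⁺¹ ≃ₕ ℝᵐ⁺² ∖ 0` (`sphereHomotopyEquivPunctured`, `PuncturedEuclidean.lean`) and homotopy
invariance of singular homology (`singularHomology.map_eq_of_homotopic`).

* `sphereToPunctured_comp_sphereReflection` — the reflection of `Sᵐ⁺¹` in `e₀ᗮ` is the
  coordinate reflection `reflPunctured 0` under `Sᵐ⁺¹ ↪ ℝᵐ⁺² ∖ 0`;
* `not_homotopic_sphereReflection_id` — it is not homotopic to the identity;
* `Diffeomorph.IsDiffeotopicToId.homotopic_id` — a diffeotopy is a homotopy;
* `Diffeomorph.isDiffeotopicToId_of_homotopic_two` — **a diffeomorphism of `S²` homotopic to the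
  identity is diffeotopic to the identity** (Smale 1959; Cerf 1968, Appendice §5).

Everything here is proved; no definition and no named fact is introduced.

## References

* A. Hatcher, *Algebraic Topology*, CUP 2002, §2.2, property (e) p. 134. [HatcherAT2002]
* J. Cerf, *Sur les difféomorphismes de la sphère de dimension trois (Γ₄ = 0)*, LNM 53 (1968),
  Appendice §5, Théorème 4 and Corollaire 2. [CerfDiffeoSphere1968]
* S. Smale, *Diffeomorphisms of the 2-sphere*, Proc. AMS 10 (1959) 621–626. [Smale1959]
-/

noncomputable section

open scoped Manifold ContDiff Topology RealInnerProductSpace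
open Set Function Metric CategoryTheory
open Literature.AlgebraicTopology.SingularHomology

namespace Literature.Topology.FourManifolds

local notation "𝔼 " k:arg => EuclideanSpace ℝ (Fin k)
local notation "𝕊 " k:arg => (Metric.sphere (0 : EuclideanSpace ℝ (Fin (k + 1))) 1)

variable {m : ℕ}

/-- **The reflection of `Sᵐ⁺¹` in `e₀ᗮ` is the coordinate reflection `(x₀, x₁, …) ↦ (-x₀, x₁, …)`
under the inclusion `Sᵐ⁺¹ ↪ ℝᵐ⁺² ∖ 0`.** [folklore] -/
theorem sphereToPunctured_comp_sphereReflection (m : ℕ) :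
    (sphereToPunctured (m + 2)).comp
        ⟨sphereReflection (sphereBasePoint (m + 1)), (sphereReflection (sphereBasePoint (m + 1))).continuous⟩ =
      (reflPunctured 0).comp (sphereToPunctured (m + 2)) := by
  have hv : ((sphereBasePoint (m + 1) : 𝕊 (m + 1)) : 𝔼 (m + 2)) = EuclideanSpace.single 0 1 := rfl
  have hv1 : ‖((sphereBasePoint (m + 1) : 𝕊 (m + 1)) : 𝔼 (m + 2))‖ = 1 := norm_eq_of_mem_sphere _
  ext x j
  show coords (m + 2) ((ℝ ∙ ((sphereBasePoint (m + 1) : 𝕊 (m + 1)) : 𝔼 (m + 2)))ᗮ.reflection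
      (x : 𝔼 (m + 2))) j = negCoord 0 (coords (m + 2) (x : 𝔼 (m + 2))) j
  rw [CapGermAlignment.reflection_orthogonal_singleton_apply hv1, map_sub, map_smul, negCoord_apply,
    Pi.sub_apply, Pi.smul_apply, smul_eq_mul, hv, EuclideanSpace.inner_single_left]
  by_cases hj : j = 0
  · subst hj
    simp [EuclideanSpace.single]
    ring
  · simp [EuclideanSpace.single, hj]

/-- **A reflection of `Sᵐ⁺¹` is not homotopic to the identity** (Hatcher 2002, §2.2 property
(e): its degree is `-1`).  If it were, then, transported along the radial homotopy equivalence
`Sᵐ⁺¹ ≃ₕ ℝᵐ⁺² ∖ 0`, the coordinate reflection of `ℝᵐ⁺² ∖ 0` would act as the identity on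
`Hₘ₊₁(ℝᵐ⁺² ∖ 0; ℤ)`, contradicting `map_reflPunctured_zero_ne_id`.
[cite: HatcherAT2002, §2.2 property (e), p. 134] -/
theorem not_homotopic_sphereReflection_id (m : ℕ) :
    ¬ (⟨sphereReflection (sphereBasePoint (m + 1)),
        (sphereReflection (sphereBasePoint (m + 1))).continuous⟩ : C(𝕊 (m + 1), 𝕊 (m + 1))).Homotopic
      (ContinuousMap.id _) := by
  intro h
  set Rc : C(𝕊 (m + 1), 𝕊 (m + 1)) := ⟨sphereReflection (sphereBasePoint (m + 1)),
    (sphereReflection (sphereBasePoint (m + 1))).continuous⟩ with hRc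
  set p := sphereToPunctured (m + 2) with hp
  set q := puncturedToSphere (m + 2) with hq
  -- `p ∘ R ≃ p`
  have h1 : (p.comp Rc).Homotopic (p.comp (ContinuousMap.id _)) :=
    ContinuousMap.Homotopic.comp (ContinuousMap.Homotopic.refl p) h
  rw [ContinuousMap.comp_id, hRc, hp, sphereToPunctured_comp_sphereReflection m] at h1
  have h2 := singularHomology.map_eq_of_homotopic (R := ℤ) (M := ℤ) h1 (m + 1)
  rw [singularHomology.map_comp] at h2
  -- `q ∘ p ≃ 𝟙`, `p ∘ q ≃ 𝟙`
  have h3 : singularHomology.map ℤ ℤ q (m + 1) ≫ singularHomology.map ℤ ℤ p (m + 1) = 𝟙 _ := by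
    have hpq : (p.comp q).Homotopic (ContinuousMap.id _) := ⟨puncturedSphereHomotopy (m + 2)⟩
    rw [← singularHomology.map_comp, singularHomology.map_eq_of_homotopic (R := ℤ) (M := ℤ) hpq,
      singularHomology.map_id]
  apply map_reflPunctured_zero_ne_id m
  calc singularHomology.map ℤ ℤ (reflPunctured (0 : Fin (m + 2))) (m + 1)
      = (singularHomology.map ℤ ℤ q (m + 1) ≫ singularHomology.map ℤ ℤ p (m + 1)) ≫
          singularHomology.map ℤ ℤ (reflPunctured (0 : Fin (m + 2))) (m + 1) := by
        rw [h3, Category.id_comp]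
    _ = singularHomology.map ℤ ℤ q (m + 1) ≫ singularHomology.map ℤ ℤ p (m + 1) := by
        rw [Category.assoc, h2]
    _ = 𝟙 _ := h3

section Homotopy

variable {EN HN : Type*} [NormedAddCommGroup EN] [NormedSpace ℝ EN] [TopologicalSpace HN]
  {J : ModelWithCorners ℝ EN HN} {N : Type*} [TopologicalSpace N] [ChartedSpace HN N]

/-- **A diffeotopy is a homotopy**: a diffeomorphism diffeotopic to the identity is homotopic to
the identity. [folklore] -/
theorem Diffeomorph.IsDiffeotopicToId.homotopic_id {φ : N ≃ₘ⟮J, J⟯ N}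
    (h : Diffeomorph.IsDiffeotopicToId φ) :
    (ContinuousMap.id N).Homotopic ⟨φ, φ.continuous⟩ := by
  obtain ⟨D, hD⟩ := h
  exact ⟨{
    toFun := fun p ↦ D.toFun p.1 p.2
    continuous_toFun := D.contMDiff_uncurry_toFun.continuous.comp
      (continuous_subtype_val.prodMap continuous_id)
    map_zero_left := fun x ↦ by simp [D.toFun_zero]
    map_one_left := fun x ↦ by
      show D.toFun 1 x = φ x
      rw [← hD, Diffeotopy.coe_stage] }⟩

end Homotopy

/-- **A diffeomorphism of `S²` homotopic to the identity is diffeotopic to the identity**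
(Smale 1959; Cerf 1968, Appendice §5: `π₀ Diff(S²) = π₀ O(3) = ℤ/2`, detected by the degree).
By Cerf's dichotomy (`Diffeomorph.isDiffeotopicToId_or_isDiffeotopic_sphereReflection_two`) the
diffeomorphism is diffeotopic to the identity or to the reflection `R` in `e₀ᗮ`; in the second
case `φ ∘ R ≃ 𝟙`, and `φ ≃ 𝟙` would give `R ≃ 𝟙`, excluded by
`not_homotopic_sphereReflection_id`. [cite: CerfDiffeoSphere1968, Appendice §5, Théorème 4, Corollaire 2]
[cite: HatcherAT2002, §2.2 property (e), p. 134] -/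
theorem Diffeomorph.isDiffeotopicToId_of_homotopic_two
    (φ : (𝕊 2) ≃ₘ⟮𝓡 2, 𝓡 2⟯ 𝕊 2)
    (hφ : (⟨φ, φ.continuous⟩ : C(𝕊 2, 𝕊 2)).Homotopic (ContinuousMap.id _)) :
    Diffeomorph.IsDiffeotopicToId φ := by
  rcases Diffeomorph.isDiffeotopicToId_or_isDiffeotopic_sphereReflection_two (sphereBasePoint 2) φ
    with h | h
  · exact h
  · exfalso
    set R := sphereReflection (sphereBasePoint 2) with hR
    have hsymm : ∀ x, R.symm x = R x := fun x ↦ by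
      conv_lhs => rw [← sphereReflectionMap_involutive (sphereBasePoint 2) x]
      exact R.symm_apply_apply (R x)
    have hhom := Diffeomorph.IsDiffeotopicToId.homotopic_id h
    have e1 : (⟨(R.symm.trans φ : (𝕊 2) ≃ₘ⟮𝓡 2, 𝓡 2⟯ 𝕊 2), (R.symm.trans φ).continuous⟩ :
        C(𝕊 2, 𝕊 2)) = (⟨φ, φ.continuous⟩ : C(𝕊 2, 𝕊 2)).comp ⟨R, R.continuous⟩ := by
      ext1 x
      show φ (R.symm x) = φ (R x)
      rw [hsymm]
    rw [e1] at hhom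
    have h2 : ((⟨φ, φ.continuous⟩ : C(𝕊 2, 𝕊 2)).comp ⟨R, R.continuous⟩).Homotopic
        ((ContinuousMap.id _).comp ⟨R, R.continuous⟩) :=
      ContinuousMap.Homotopic.comp hφ (ContinuousMap.Homotopic.refl _)
    rw [ContinuousMap.id_comp] at h2
    exact not_homotopic_sphereReflection_id 1 (hhom.trans h2).symm

/-- **Homotopic to the identity ⇒ diffeotopic to the identity, from a Cerf dichotomy.**  If every
diffeomorphism of `Sᵐ⁺¹` is diffeotopic to the identity or to the reflection `R` in `e₀ᗮ`
(`π₀ O(m + 2) ↠ π₀ Diff(Sᵐ⁺¹)`), then a diffeomorphism `φ` of `Sᵐ⁺¹` homotopic to the identity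
is diffeotopic to it: otherwise `φ ∘ R ≃ 𝟙` and `φ ≃ 𝟙` give `R ≃ 𝟙`, excluded by
`not_homotopic_sphereReflection_id`. [cite: HatcherAT2002, §2.2 property (e), p. 134] -/
theorem Diffeomorph.isDiffeotopicToId_of_homotopic_of_dichotomy (m : ℕ)
    (hdich : ∀ ψ : (𝕊 (m + 1)) ≃ₘ⟮𝓡 (m + 1), 𝓡 (m + 1)⟯ 𝕊 (m + 1),
      Diffeomorph.IsDiffeotopicToId ψ ∨
        Diffeomorph.IsDiffeotopic (sphereReflection (sphereBasePoint (m + 1))) ψ)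
    (φ : (𝕊 (m + 1)) ≃ₘ⟮𝓡 (m + 1), 𝓡 (m + 1)⟯ 𝕊 (m + 1))
    (hφ : (⟨φ, φ.continuous⟩ : C(𝕊 (m + 1), 𝕊 (m + 1))).Homotopic (ContinuousMap.id _)) :
    Diffeomorph.IsDiffeotopicToId φ := by
  rcases hdich φ with h | h
  · exact h
  · exfalso
    set R := sphereReflection (sphereBasePoint (m + 1)) with hR
    have hsymm : ∀ x, R.symm x = R x := fun x ↦ by
      conv_lhs => rw [← sphereReflectionMap_involutive (sphereBasePoint (m + 1)) x]
      exact R.symm_apply_apply (R x)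
    have hhom := Diffeomorph.IsDiffeotopicToId.homotopic_id h
    have e1 : (⟨(R.symm.trans φ : (𝕊 (m + 1)) ≃ₘ⟮𝓡 (m + 1), 𝓡 (m + 1)⟯ 𝕊 (m + 1)),
        (R.symm.trans φ).continuous⟩ : C(𝕊 (m + 1), 𝕊 (m + 1))) =
        (⟨φ, φ.continuous⟩ : C(𝕊 (m + 1), 𝕊 (m + 1))).comp ⟨R, R.continuous⟩ := by
      ext1 x
      show φ (R.symm x) = φ (R x)
      rw [hsymm]
    rw [e1] at hhom
    have h2 : ((⟨φ, φ.continuous⟩ : C(𝕊 (m + 1), 𝕊 (m + 1))).comp ⟨R, R.continuous⟩).Homotopic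
        ((ContinuousMap.id _).comp ⟨R, R.continuous⟩) :=
      ContinuousMap.Homotopic.comp hφ (ContinuousMap.Homotopic.refl _)
    rw [ContinuousMap.id_comp] at h2
    exact not_homotopic_sphereReflection_id m (hhom.trans h2).symm

/-- **A diffeomorphism of the circle homotopic to the identity is diffeotopic to the identity**
(`π₀ Diff(S¹) = π₀ O(2) = ℤ/2`, detected by the degree; Cerf 1968, Appendice §5, Prop. 4 at
`n = 1`, `i = 0`, in the tree's form `Diffeomorph.isDiffeotopicToId_or_isDiffeotopic_sphereReflection_circle`).
[cite: CerfDiffeoSphere1968, Appendice §5, Prop. 4] [cite: HatcherAT2002, §2.2 property (e), p. 134] -/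
theorem Diffeomorph.isDiffeotopicToId_of_homotopic_one
    (φ : (𝕊 1) ≃ₘ⟮𝓡 1, 𝓡 1⟯ 𝕊 1)
    (hφ : (⟨φ, φ.continuous⟩ : C(𝕊 1, 𝕊 1)).Homotopic (ContinuousMap.id _)) :
    Diffeomorph.IsDiffeotopicToId φ :=
  Diffeomorph.isDiffeotopicToId_of_homotopic_of_dichotomy 0
    (Diffeomorph.isDiffeotopicToId_or_isDiffeotopic_sphereReflection_circle (sphereBasePoint 1)) φ hφ

end Literature.Topology.FourManifolds

end
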